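import Literature.Analysis.Complex.Montel
import Literature.Analysis.Complex.Hurwitz
import Mathlib.Analysis.Complex.Liouville
import Mathlib.Topology.Order.IsLUB
import HarnessLib

/-!
# Uniformization of plane domains, brick N1b: an extremal holomorphic map `𝔻 → U` exists

PROOF-ONLY file (no definitions; abc-iut cell, seat abc-iut-w5-d030 gen 9, brick «UNIF-G1P N1b» of abc-iut-L4-t8's
programme behind the named fact `Complex.PlaneDomainDiscCovering`, GAP row G-L4t8g7-1). Y. Fisher, J. H. Hubbard,
B. S. Wittner, *A proof of the uniformization theorem for arbitrary plane domains*, Proc. Amer. Math. Soc. **104**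
(1988) 413–418: the universal covering `𝔻 → U` of a plane domain `U` omitting two points is obtained as a holomorphic
map `f : 𝔻 → U`, `f(0) = a`, MAXIMISING `|f′(0)|` among all holomorphic maps `𝔻 → U` taking `0` to `a`; the three
steps are (N1a) the family is normal (lift through the modular function `λ : ℍ → ℂ ∖ {0,1}`, then Montel), (N1b) an
extremal map exists, (N1c) an extremal map is a covering. THIS FILE proves (N1b) in the shape Montel's theorem
consumes, with the normality bound of (N1a) as the HYPOTHESIS `hb` (local uniform bounds on the family, exactly the
hypothesis of the tree's `Complex.exists_strictMono_tendstoLocallyUniformlyOn_deriv`):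

* `Complex.norm_deriv_zero_le_of_locallyBounded` — the Cauchy estimate: under `hb`, `‖f′(0)‖` is bounded on the
  family;
* **`Complex.exists_norm_deriv_max_of_locallyBounded`** — for ANY `U ⊆ ℂ` (openness is not needed here), `a ∈ U`, and the family
  `𝓕 = {f : ℂ → ℂ | f holomorphic on 𝔻, f(𝔻) ⊆ U, f 0 = a}` locally uniformly bounded on `𝔻`, there is `f ∈ 𝓕` with
  `‖g′(0)‖ ≤ ‖f′(0)‖` for every `g ∈ 𝓕`. Proof: a maximising sequence has a locally uniformly convergent subsequence
  with convergent derivatives (Montel, tree); the limit takes `0` to `a`, and it maps `𝔻` into `U` by Hurwitz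
  (tree: `Complex.hurwitz_eqOn_zero_or_forall_ne_zero` applied to `f_n − b` for `b ∉ U` — the alternative
  `f − b ≡ 0` is excluded by `f(0) = a ≠ b`).

Classical mathematics (Conway VII.2, VII.4 technique); nothing here touches [IUTchIII] Cor. 3.12.
[cite: FisherHubbardWittner1988, Theorem p.413] [cite: Conway1978, Ch. VII Thm. 2.9]
-/

noncomputable section

open Set Metric Filter Topology Function

namespace Complex

variable {U : Set ℂ} {a : ℂ}

/-- **Cauchy bound on the family at the centre.** If the family of holomorphic maps `𝔻 → U` with `f 0 = a` is
uniformly bounded near `0`, then `‖f′(0)‖` is bounded on the family. [cite: Conway1978, Ch. VII Thm. 2.9] -/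
theorem norm_deriv_zero_le_of_locallyBounded {M r : ℝ} (hr : 0 < r) (hr1 : r ≤ 1)
    (hM : ∀ f : ℂ → ℂ, DifferentiableOn ℂ f (ball 0 1) → MapsTo f (ball 0 1) U → f 0 = a →
      ∀ z ∈ ball (0 : ℂ) r, ‖f z‖ ≤ M)
    {f : ℂ → ℂ} (hf : DifferentiableOn ℂ f (ball 0 1)) (hfU : MapsTo f (ball 0 1) U) (hf0 : f 0 = a) :
    ‖deriv f 0‖ ≤ M / (r / 2) := by
  have hr2 : 0 < r / 2 := by positivity
  have hsub : closedBall (0 : ℂ) (r / 2) ⊆ ball 0 r := closedBall_subset_ball (by linarith)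
  have hsub1 : ball (0 : ℂ) r ⊆ ball 0 1 := ball_subset_ball hr1
  have hd : DiffContOnCl ℂ f (ball 0 (r / 2)) := by
    refine DifferentiableOn.diffContOnCl ?_
    rw [closure_ball (0 : ℂ) hr2.ne']
    exact hf.mono (hsub.trans hsub1)
  refine norm_deriv_le_of_forall_mem_sphere_norm_le hr2 hd fun z hz => ?_
  exact hM f hf hfU hf0 z (hsub (sphere_subset_closedBall hz))

/-- **Brick N1b (Fisher–Hubbard–Wittner): an extremal map exists.** For `U ⊆ ℂ` (any subset), `a ∈ U`, if the family
`𝓕 = {f | f holomorphic on 𝔻, f(𝔻) ⊆ U, f 0 = a}` is locally uniformly bounded on `𝔻` (brick N1a: normality via the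
`λ`-lift), then some `f ∈ 𝓕` maximises `‖f′(0)‖` over `𝓕`. [cite: FisherHubbardWittner1988, Theorem p.413] -/
theorem exists_norm_deriv_max_of_locallyBounded (ha : a ∈ U)
    (hb : ∀ c ∈ ball (0 : ℂ) 1, ∃ M : ℝ, ∃ r > 0, ∀ f : ℂ → ℂ, DifferentiableOn ℂ f (ball 0 1) →
      MapsTo f (ball 0 1) U → f 0 = a → ∀ z ∈ ball c r ∩ ball 0 1, ‖f z‖ ≤ M) :
    ∃ f : ℂ → ℂ, DifferentiableOn ℂ f (ball 0 1) ∧ MapsTo f (ball 0 1) U ∧ f 0 = a ∧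
      ∀ g : ℂ → ℂ, DifferentiableOn ℂ g (ball 0 1) → MapsTo g (ball 0 1) U → g 0 = a →
        ‖deriv g 0‖ ≤ ‖deriv f 0‖ := by
  classical
  -- the family as a predicate
  set P : (ℂ → ℂ) → Prop := fun f =>
    DifferentiableOn ℂ f (ball 0 1) ∧ MapsTo f (ball 0 1) U ∧ f 0 = a with hP
  -- the set of values `‖f′(0)‖`, nonempty (constant map) and bounded above (Cauchy estimate at 0)
  set S : Set ℝ := {x | ∃ f, P f ∧ x = ‖deriv f 0‖} with hS
  have hconst : P (fun _ => a) := ⟨differentiableOn_const _, fun _ _ => ha, rfl⟩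
  have hSne : S.Nonempty := ⟨‖deriv (fun _ : ℂ => a) 0‖, fun _ => a, hconst, rfl⟩
  obtain ⟨M₀, r₀, hr₀, hM₀⟩ := hb 0 (mem_ball_self one_pos)
  set r₁ := min r₀ 1 with hr₁
  have hr₁pos : 0 < r₁ := lt_min hr₀ one_pos
  have hr₁le : r₁ ≤ 1 := min_le_right _ _
  have hM₁ : ∀ f : ℂ → ℂ, DifferentiableOn ℂ f (ball 0 1) → MapsTo f (ball 0 1) U → f 0 = a →
      ∀ z ∈ ball (0 : ℂ) r₁, ‖f z‖ ≤ M₀ := fun f hf hfU hf0 z hz =>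
    hM₀ f hf hfU hf0 z ⟨ball_subset_ball (min_le_left _ _) hz, ball_subset_ball hr₁le hz⟩
  have hSbdd : BddAbove S := by
    refine ⟨M₀ / (r₁ / 2), ?_⟩
    rintro x ⟨f, ⟨hf, hfU, hf0⟩, rfl⟩
    exact norm_deriv_zero_le_of_locallyBounded hr₁pos hr₁le hM₁ hf hfU hf0
  -- a maximising sequence
  obtain ⟨u, -, hu, huS⟩ := exists_seq_tendsto_sSup hSne hSbdd
  choose g hg hgu using huS
  -- Montel: a locally uniformly convergent subsequence with convergent derivatives
  obtain ⟨f, φ, hφ, hfd, hlim, hlim'⟩ :=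
    exists_strictMono_tendstoLocallyUniformlyOn_deriv (U := ball (0 : ℂ) 1) isOpen_ball
      (F := g) (fun n => (hg n).1)
      (fun c hc => by
        obtain ⟨M, r, hr, hM⟩ := hb c hc
        exact ⟨M, r, hr, fun n z hz => hM (g n) (hg n).1 (hg n).2.1 (hg n).2.2 z hz⟩)
  -- the limit takes `0` to `a`
  have hf0 : f 0 = a := by
    have h1 : Tendsto (fun n => g (φ n) 0) atTop (𝓝 (f 0)) := hlim.tendsto_at (mem_ball_self one_pos)
    have h2 : (fun n => g (φ n) 0) = fun _ => a := funext fun n => (hg (φ n)).2.2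
    rw [h2] at h1
    exact (tendsto_nhds_unique tendsto_const_nhds h1).symm
  -- `‖f′(0)‖ = sup S`
  have hfd0 : ‖deriv f 0‖ = sSup S := by
    have h1 : Tendsto (fun n => deriv (g (φ n)) 0) atTop (𝓝 (deriv f 0)) :=
      hlim'.tendsto_at (mem_ball_self one_pos)
    have h2 : Tendsto (fun n => ‖deriv (g (φ n)) 0‖) atTop (𝓝 (sSup S)) := by
      have : (fun n => ‖deriv (g (φ n)) 0‖) = u ∘ φ := funext fun n => (hgu (φ n)).symm
      rw [this]
      exact hu.comp hφ.tendsto_atTop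
    exact tendsto_nhds_unique h1.norm h2
  -- the limit maps `𝔻` into `U` (Hurwitz)
  have hfU : MapsTo f (ball 0 1) U := by
    intro z hz
    by_contra hzU
    set b := f z with hb'
    have hab : a ≠ b := fun h => hzU (h ▸ ha)
    -- `g (φ n) - b → f - b` locally uniformly on `𝔻`, each `g (φ n) - b` zero-free
    have hlimb : TendstoLocallyUniformlyOn (fun n w => g (φ n) w - b) (fun w => f w - b) atTop (ball 0 1) :=
      hlim.sub (tendsto_const_nhds.tendstoUniformlyOn_const (ball (0 : ℂ) 1)).tendstoLocallyUniformlyOn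
    have hFb : ∀ᶠ n in atTop, DifferentiableOn ℂ (fun w => g (φ n) w - b) (ball 0 1) :=
      Eventually.of_forall fun n => (hg (φ n)).1.sub_const b
    have h0 : ∃ᶠ n in atTop, ∀ w ∈ ball (0 : ℂ) 1, g (φ n) w - b ≠ 0 :=
      (Eventually.of_forall fun n w hw h0 => by
        have hw' : g (φ n) w = b := sub_eq_zero.1 h0
        exact hzU (hw' ▸ (hg (φ n)).2.1 hw)).frequently
    rcases hurwitz_eqOn_zero_or_forall_ne_zero isOpen_ball (convex_ball (0 : ℂ) 1).isPreconnected hFb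
      hlimb h0 with h | h
    · have : f 0 - b = 0 := h (mem_ball_self one_pos)
      exact hab (by rw [← hf0]; exact sub_eq_zero.1 this)
    · exact h z hz (sub_self _)
  refine ⟨f, hfd, hfU, hf0, fun g' hg' hg'U hg'0 => ?_⟩
  rw [hfd0]
  exact le_csSup hSbdd ⟨g', ⟨hg', hg'U, hg'0⟩, rfl⟩

end Complex

end
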